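import Summits.PneNP.PneNP.Theorems.SymmetryBudgetNoHiddenOrderProgramSrcsA

/-!
# `NoHiddenOrder` (stmt-PneNP-14781), (R2c) VI: the window canoniser program — kinds and sources of the walk shapes

Route `PneNP/SymmetryBudget`; continues `SymmetryBudgetNoHiddenOrderProgramSrcsA.lean`.  Kinds, sources and local levels of the analysis
shape `AnGate` (a `DAnalysis`: `ValOrd`, `Comps` = `Switching` + `Reach`, `MinCell`, and the classification gates) and of the transition
shape `TrGate` (a `Decode` stage: individualised order, `RefVal`, selectors and multiplexers), as functions of the stage's input wires
`AnIn`, of the label `L` (its `U`, `X`, `λ`) and of the embeddings.  Definitions only; supports stmt-PneNP-14781.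
-/

set_option linter.dupNamespace false -- `Summit.PneNP.PneNP.…` (D-0017 single-conjunct layout)

namespace Summit.PneNP.PneNP.Theorems

open Finset CGBits BranchSum Literature.Computability.Complexity Literature.Computability.Complexity.SymProg

namespace WCanon

variable {m : ℕ}

/-- The block of a label. -/
abbrev lU (L : FLab m) : Finset (WV m) := L.1.1

/-- The consumed points of a label. -/
abbrev lX (L : FLab m) : Finset (WV m) := L.1.2.1

/-- The multiplicities of a label, as naturals. -/
abbrev lLam (L : FLab m) (v : WV m) : ℕ := (L.1.2.2 v : ℕ)

/-- The input wires of a walk state: membership, one-hot values, consumed points, dead flag, adjacency. [folklore] -/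
structure AnIn (m : ℕ) where
  /-- membership -/
  mem : WV m → Wire m
  /-- one-hot colour values -/
  val : WV m → Fin (wn m) → Wire m
  /-- consumed points -/
  cons : WV m → Wire m
  /-- dead flag -/
  dead : Wire m
  /-- adjacency -/
  adj : WV m → WV m → Wire m

/-! ### The analysis shape -/

/-- Kinds of the analysis shape of label `L`. [folklore] -/
def anKind (L : FLab m) : AnGate m → Kind
  | .oPr _ _ _ _ => .and
  | .oLt _ _ => .or
  | .oEq _ _ => .or
  | .swPr _ _ _ _ => .and
  | .swApr _ _ _ _ => .and
  | .swTw _ _ g => ctKind g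
  | .swNadj _ _ => .nor
  | .swNtw _ _ => .nor
  | .swKept _ _ => .and
  | .swAdded _ _ => .and
  | .swSw' _ _ => .or
  | .swSw u v => if u = v then .or else .and
  | .rE _ _ => .and
  | .rMid _ _ _ _ => .and
  | .rR i u v => if (i : ℕ) = 0 then (if u = v then .and else .or) else .or
  | .mcCy _ _ => .and
  | .mcBig _ => .atLeast 2
  | .mcCmp _ _ g => ccKind g
  | .mcTieLT _ _ => .and
  | .mcBo _ _ => .or
  | .mcBetter _ _ => .and
  | .mcNobetter _ => .nor
  | .mcSel _ => .and
  | .nmem _ => .nor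
  | .ncons _ => .nor
  | .cov _ _ => .or
  | .all _ => .and
  | .nall _ => .nor
  | .disc _ => .and
  | .isAND => .or
  | .nisAND => .nor
  | .big2 => .atLeast 2
  | .nbig2 => .nor
  | .isOR => .and
  | .stop => .and
  | .frozen => .or
  | .nfrozen => .nor
  | .cand y => if y ∈ lX L then .and else .or
  | .ncand _ => .nor
  | .dom _ => .and
  | .ndom _ => .nor
  | .go => .or
  | .ngo => .nor
  | .andok => if (lU L).Nonempty then .and else .or
  | .nandok => .nor

/-- Sources of the analysis shape of label `L` with inputs `ι`, embedded by `e`. [folklore] -/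
def anSrcs (L : FLab m) (ι : AnIn m) (e : AnGate m → Gt m) : AnGate m → Finset (Wire m)
  | .oPr u v c c' => {ι.val u c, ι.val v c'}
  | .oLt u v =>
      ((univ : Finset (Fin (wn m) × Fin (wn m))).filter fun cc => cc.1 < cc.2).image fun cc => Sum.inr (e (.oPr u v cc.1 cc.2))
  | .oEq u v => (univ : Finset (Fin (wn m))).image fun c => Sum.inr (e (.oPr u v c c))
  | .swPr u v a b => {ι.mem a, ι.mem b, Sum.inr (e (.oEq a u)), Sum.inr (e (.oEq b v))}
  | .swApr u v a b => {Sum.inr (e (.swPr u v a b)), ι.adj a b}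
  | .swTw u v g =>
      ctSrcs (univ.image fun ab : WV m × WV m => Sum.inr (e (.swPr u v ab.1 ab.2)))
        (univ.image fun ab : WV m × WV m => Sum.inr (e (.swApr u v ab.1 ab.2))) (fun g' => e (.swTw u v g')) g
  | .swNadj u v => {ι.adj u v}
  | .swNtw u v => {Sum.inr (e (.swTw u v .tw))}
  | .swKept u v => {ι.adj u v, Sum.inr (e (.swNtw u v))}
  | .swAdded u v => {Sum.inr (e (.swNadj u v)), Sum.inr (e (.swTw u v .tw))}
  | .swSw' u v => {Sum.inr (e (.swKept u v)), Sum.inr (e (.swAdded u v))}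
  | .swSw u v => if u = v then ∅ else {ι.mem u, ι.mem v, Sum.inr (e (.swSw' u v))}
  | .rE u v => {ι.mem u, ι.mem v, Sum.inr (e (.swSw u v))}
  | .rMid i u w v => {Sum.inr (e (.rR i.castSucc u w)), Sum.inr (e (.rE w v))}
  | .rR i u v =>
      if _h : (i : ℕ) = 0 then (if u = v then {ι.mem u} else ∅) else
        insert (Sum.inr (e (.rR ⟨i - 1, by omega⟩ u v))) (univ.image fun w => Sum.inr (e (.rMid ⟨i - 1, by omega⟩ u w v)))
  | .mcCy u y => {ι.mem y, Sum.inr (e (.oEq y u))}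
  | .mcBig u => univ.image fun y => Sum.inr (e (.mcCy u y))
  | .mcCmp v u g =>
      ccSrcs (univ.image fun y => Sum.inr (e (.mcCy v y))) (univ.image fun y => Sum.inr (e (.mcCy u y))) (fun g' => e (.mcCmp v u g')) g
  | .mcTieLT v u => {Sum.inr (e (.mcCmp v u .eq)), Sum.inr (e (.oLt v u))}
  | .mcBo v u => {Sum.inr (e (.mcCmp v u .lt)), Sum.inr (e (.mcTieLT v u))}
  | .mcBetter v u => {ι.mem v, Sum.inr (e (.mcBig v)), Sum.inr (e (.mcBo v u))}
  | .mcNobetter u => univ.image fun v => Sum.inr (e (.mcBetter v u))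
  | .mcSel u => {ι.mem u, Sum.inr (e (.mcBig u)), Sum.inr (e (.mcNobetter u))}
  | .nmem v => {ι.mem v}
  | .ncons v => {ι.cons v}
  | .cov u w => {Sum.inr (e (.nmem w)), Sum.inr (e (.rR (Fin.last (wn m)) u w))}
  | .all u => univ.image fun w => Sum.inr (e (.cov u w))
  | .nall u => {Sum.inr (e (.all u))}
  | .disc u => {ι.mem u, Sum.inr (e (.nall u))}
  | .isAND => univ.image fun u => Sum.inr (e (.disc u))
  | .nisAND => {Sum.inr (e .isAND)}
  | .big2 => univ.image ι.mem
  | .nbig2 => {Sum.inr (e .big2)}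
  | .isOR => {Sum.inr (e .nisAND), Sum.inr (e .big2)}
  | .stop =>
      ((lU L).image ι.mem ∪ (univ \ lU L).image fun v => Sum.inr (e (.nmem v))) ∪
        ((lX L).image ι.cons ∪ (univ \ lX L).image fun v => Sum.inr (e (.ncons v)))
  | .frozen => {ι.dead, Sum.inr (e .stop)}
  | .nfrozen => {Sum.inr (e .frozen)}
  | .cand y => if y ∈ lX L then {ι.mem y, Sum.inr (e (.mcSel y)), Sum.inr (e (.ncons y))} else ∅
  | .ncand y => {Sum.inr (e (.cand y))}
  | .dom y =>
      insert (Sum.inr (e (.cand y))) (((lX L).filter fun z => z ≠ y ∧ lLam L y ≤ lLam L z).image fun z => Sum.inr (e (.ncand z)))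
  | .ndom y => {Sum.inr (e (.dom y))}
  | .go => (lX L).image fun y => Sum.inr (e (.dom y))
  | .ngo => {Sum.inr (e .go)}
  | .andok =>
      if (lU L).Nonempty then (lU L ×ˢ lU L).image fun uu => Sum.inr (e (.rR (Fin.last (wn m)) uu.1 uu.2)) else ∅
  | .nandok => {Sum.inr (e .andok)}

/-! ### The transition shape -/

/-- The refinement inputs of a transition: the state's membership and adjacency, the individualised order and kernel. [folklore] -/
def trRIIn (σ : AnIn m) (e : TrGate m → Gt m) : RIIn m where
  mem := σ.mem
  adj := σ.adj
  lt0 u v := Sum.inr (e (.ltI u v))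
  eq0 u v := Sum.inr (e (.eqI u v))

/-- Kinds of the transition shape. [folklore] -/
def trKind : TrGate m → Kind
  | .tieD _ _ => .and
  | .ltI _ _ => .or
  | .bothD _ _ => .and
  | .noneD _ _ => .nor
  | .deqv _ _ => .or
  | .eqI _ _ => .and
  | .rv g => riKind g
  | .takeAnd => .and
  | .ntakeAnd => .nor
  | .takeOr => .and
  | .ntakeOr => .nor
  | .newMem _ => .or
  | .m1 _ => .and
  | .m2 _ => .and
  | .mx _ => .or
  | .v1 _ _ => .and
  | .v2 _ _ => .and
  | .vx _ _ => .or
  | .c1 _ => .and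
  | .cx _ => .or
  | .d1 => .and
  | .d2 => .and
  | .d3 => .and
  | .dx => .or

/-- Sources of the transition shape of label `L` from the state with inputs `σ`, whose analysis is embedded by `ea`, embedded by `e`.
[folklore] -/
def trSrcs (L : FLab m) (σ : AnIn m) (ea : AnGate m → Gt m) (e : TrGate m → Gt m) : TrGate m → Finset (Wire m)
  | .tieD u v => {Sum.inr (ea (.oEq u v)), Sum.inr (ea (.ndom u)), Sum.inr (ea (.dom v))}
  | .ltI u v => {Sum.inr (ea (.oLt u v)), Sum.inr (e (.tieD u v))}
  | .bothD u v => {Sum.inr (ea (.dom u)), Sum.inr (ea (.dom v))}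
  | .noneD u v => {Sum.inr (ea (.dom u)), Sum.inr (ea (.dom v))}
  | .deqv u v => {Sum.inr (e (.bothD u v)), Sum.inr (e (.noneD u v))}
  | .eqI u v => {Sum.inr (ea (.oEq u v)), Sum.inr (e (.deqv u v))}
  | .rv g => riSrcs (trRIIn σ e) (fun g' => e (.rv g')) g
  | .takeAnd => {Sum.inr (ea .nfrozen), Sum.inr (ea .isAND), Sum.inr (ea .andok)}
  | .ntakeAnd => {Sum.inr (e .takeAnd)}
  | .takeOr => {Sum.inr (ea .nfrozen), Sum.inr (ea .isOR), Sum.inr (ea .go)}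
  | .ntakeOr => {Sum.inr (e .takeOr)}
  | .newMem w => (lU L).image fun u => Sum.inr (ea (.rR (Fin.last (wn m)) u w))
  | .m1 v => {σ.mem v, Sum.inr (e .ntakeAnd)}
  | .m2 v => {Sum.inr (e .takeAnd), Sum.inr (e (.newMem v))}
  | .mx v => {Sum.inr (e (.m1 v)), Sum.inr (e (.m2 v))}
  | .v1 v c => {Sum.inr (e .takeOr), Sum.inr (e (.rv (.vval v c)))}
  | .v2 v c => {Sum.inr (e .ntakeOr), σ.val v c}
  | .vx v c => {Sum.inr (e (.v1 v c)), Sum.inr (e (.v2 v c))}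
  | .c1 v => {Sum.inr (e .takeOr), Sum.inr (ea (.dom v))}
  | .cx v => {σ.cons v, Sum.inr (e (.c1 v))}
  | .d1 => {Sum.inr (ea .nfrozen), Sum.inr (ea .isAND), Sum.inr (ea .nandok)}
  | .d2 => {Sum.inr (ea .nfrozen), Sum.inr (ea .isOR), Sum.inr (ea .ngo)}
  | .d3 => {Sum.inr (ea .nfrozen), Sum.inr (ea .nisAND), Sum.inr (ea .nbig2)}
  | .dx => {σ.dead, Sum.inr (e .d1), Sum.inr (e .d2), Sum.inr (e .d3)}

/-! ### State wires -/

/-- The membership wire of stage `k` of the walk of `L`: everything at stage `0` — the TRUE wire `sig (eqall v v)`, distinct for distinct `v`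
as the analysis' counting gates require —, the multiplexer output afterwards. [folklore] -/
def memW (L : FLab m) (k : Fin (pF m + 1)) (v : WV m) : Wire m :=
  if _h : (k : ℕ) = 0 then Sum.inr (.sig (.eqall v v)) else Sum.inr (.tr L ⟨k - 1, by omega⟩ (.mx v))

/-- The value wires of stage `k`: the root colouring at stage `0`. [folklore] -/
def valW (L : FLab m) (k : Fin (pF m + 1)) (v : WV m) (c : Fin (wn m)) : Wire m :=
  if _h : (k : ℕ) = 0 then Sum.inr (.root (.vval v c)) else Sum.inr (.tr L ⟨k - 1, by omega⟩ (.vx v c))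

/-- The consumed wires of stage `k`: nothing at stage `0`. [folklore] -/
def consW (L : FLab m) (k : Fin (pF m + 1)) (v : WV m) : Wire m :=
  if _h : (k : ℕ) = 0 then Sum.inr .ff else Sum.inr (.tr L ⟨k - 1, by omega⟩ (.cx v))

/-- The dead wire of stage `k`: alive at stage `0`. [folklore] -/
def deadW (L : FLab m) (k : Fin (pF m + 1)) : Wire m :=
  if _h : (k : ℕ) = 0 then Sum.inr .ff else Sum.inr (.tr L ⟨k - 1, by omega⟩ .dx)

/-- The input record of stage `k` of the walk of `L`. [folklore] -/
def stIn (L : FLab m) (k : Fin (pF m + 1)) : AnIn m where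
  mem := memW L k
  val := valW L k
  cons := consW L k
  dead := deadW L k
  adj := adjWire

end WCanon

end Summit.PneNP.PneNP.Theorems
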